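import Summits.NavierStokesRegularity.NavierStokesRegularity.Theorems.OddMorawetzLocal.Negative.OddMorawetzLocalJetAlgebra
import Literature.Analysis.Calculus.IteratedFDerivSymmetric
import HarnessLib

/-!
# The total derivative of jet polynomials is the partial derivative along jets of smooth fields

Calculus over the computable jet algebra of `OddMorawetzLocalJetAlgebra.lean` (crux `OddMorawetzLocal`,
item stmt-NavierStokesRegularity-1376, refutation skeleton, registered stub `D_sound`); Mathlib plus the tree's
all-orders Schwarz–Clairaut theorem `Literature.Analysis.Calculus.iteratedFDeriv_comp_perm_of_contDiff`;
no definitions, no named facts.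

For a smooth field `u : ℝ³ → ℝ³` the jet coordinates `jetVal u x (a, l) = Dⁿu(x)(e_{l₁}, …, e_{lₙ})_a` are smooth in
`x`, and the directional derivative of such a coordinate along `e_i` is the coordinate with `i` inserted into the
(sorted) index list: `∂_i (Dⁿu(·)(e_l)_a)(x) = Dⁿ⁺¹u(x)(e_i, e_l)_a = Dⁿ⁺¹u(x)(e_{insertIdx i l})_a`, the last step
being the symmetry of `Dⁿ⁺¹u(x)` under the permutation moving `e_i` to its sorted position (an induction on `l`
using only the transposition of the first two slots).  By the Leibniz rule over the variables of a monomial and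
linearity over the terms, the value of a jet polynomial `p` along the jets of `u` is smooth and
`∂_i (p ∘ jetVal u) = (D i p) ∘ jetVal u`, where `JPoly.D i` is the list-level total derivative of the jet algebra
(`D_sound`).  The argument family of an index list `l` is written `stdVec ∘ l.get`.
-/

noncomputable section

set_option linter.dupNamespace false
set_option autoImplicit false

namespace Summit.NavierStokesRegularity.NavierStokesRegularity.Theorems.OddMorawetz

/-- The argument family of `j :: l` is `e_j` followed by the family of `l`. -/
private theorem stdVec_comp_get_cons (j : Fin 3) (l : List (Fin 3)) :
    stdVec ∘ (j :: l).get = Fin.cons (stdVec j) (stdVec ∘ l.get) := by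
  funext t
  exact Fin.cases rfl (fun _ => rfl) t

/-- Unfolding of a jet coordinate: `jetVal u x (a, l) = D^{|l|}u(x)(e_{l₁}, …, e_{lₙ})_a`. -/
private theorem jetVal_pair (u : EuclideanSpace ℝ (Fin 3) → EuclideanSpace ℝ (Fin 3))
    (x : EuclideanSpace ℝ (Fin 3)) (a : Fin 3) (l : List (Fin 3)) :
    jetVal u x (a, l) = iteratedFDeriv ℝ l.length u x (stdVec ∘ l.get) a := rfl

/-- Swapping the first two entries of a tuple: `(a, b, w) ∘ swap 0 1 = (b, a, w)`. -/
private theorem cons_cons_comp_swap {α : Type*} {n : ℕ} (a b : α) (w : Fin n → α) :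
    (Fin.cons a (Fin.cons b w) : Fin (n + 2) → α) ∘ Equiv.swap 0 1 = Fin.cons b (Fin.cons a w) := by
  rw [Literature.Analysis.Calculus.comp_swap_zero_one_eq_cons_cons]
  simp only [Fin.cons_zero, Fin.cons_one, Fin.tail_cons]

variable {u : EuclideanSpace ℝ (Fin 3) → EuclideanSpace ℝ (Fin 3)}

/-- Every iterated derivative of a smooth map is differentiable. -/
private theorem differentiableAt_iteratedFDeriv_of_contDiff (hu : ContDiff ℝ (⊤ : ℕ∞) u) (n : ℕ)
    (x : EuclideanSpace ℝ (Fin 3)) : DifferentiableAt ℝ (iteratedFDeriv ℝ n u) x :=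
  (hu.differentiable_iteratedFDeriv (WithTop.coe_lt_coe.2 (ENat.coe_lt_top n))).differentiableAt

/-- Every iterated derivative of a smooth map is smooth. -/
private theorem contDiff_iteratedFDeriv_of_contDiff (hu : ContDiff ℝ (⊤ : ℕ∞) u) (n : ℕ) :
    ContDiff ℝ (⊤ : ℕ∞) (iteratedFDeriv ℝ n u) :=
  hu.iteratedFDeriv_right (by exact_mod_cast le_top)

/-- `Dⁿ⁺¹u(x)(w, m) = ∂_w (y ↦ Dⁿu(y)(m))(x)` for smooth `u`. -/
private theorem iteratedFDeriv_cons_eq_fderiv (hu : ContDiff ℝ (⊤ : ℕ∞) u) {n : ℕ}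
    (w : EuclideanSpace ℝ (Fin 3)) (m : Fin n → EuclideanSpace ℝ (Fin 3)) (x : EuclideanSpace ℝ (Fin 3)) :
    iteratedFDeriv ℝ (n + 1) u x (Fin.cons w m) = fderiv ℝ (fun y => iteratedFDeriv ℝ n u y m) x w := by
  rw [iteratedFDeriv_succ_apply_left, Fin.cons_zero, Fin.tail_cons,
    fderiv_continuousMultilinear_apply_const_apply (differentiableAt_iteratedFDeriv_of_contDiff hu n x) m w]

/-- **Sorted insertion does not change the derivative** (symmetry of `Dⁿ⁺¹u(x)` for smooth `u`):
`D^{|insertIdx i l|}u(x)(e_{insertIdx i l}) = D^{|l|+1}u(x)(e_i, e_l)`.  Induction on `l`: when `i` moves past the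
head `j`, differentiate the inductive identity once more in the direction `e_j` and swap the first two slots. -/
private theorem iteratedFDeriv_insertIdx (hu : ContDiff ℝ (⊤ : ℕ∞) u) (i : Fin 3) (l : List (Fin 3)) :
    ∀ x : EuclideanSpace ℝ (Fin 3),
      iteratedFDeriv ℝ (insertIdx i l).length u x (stdVec ∘ (insertIdx i l).get) =
        iteratedFDeriv ℝ (l.length + 1) u x (stdVec ∘ (i :: l).get) := by
  induction l with
  | nil => intro x; rfl
  | cons j js ih =>
    intro x
    by_cases h : j < i
    · rw [show insertIdx i (j :: js) = j :: insertIdx i js by simp [insertIdx, h]]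
      calc iteratedFDeriv ℝ (j :: insertIdx i js).length u x (stdVec ∘ (j :: insertIdx i js).get)
          = iteratedFDeriv ℝ ((insertIdx i js).length + 1) u x
              (Fin.cons (stdVec j) (stdVec ∘ (insertIdx i js).get)) := by
            rw [stdVec_comp_get_cons]; rfl
        _ = fderiv ℝ (fun y => iteratedFDeriv ℝ (insertIdx i js).length u y (stdVec ∘ (insertIdx i js).get)) x
              (stdVec j) := iteratedFDeriv_cons_eq_fderiv hu _ _ x
        _ = fderiv ℝ (fun y => iteratedFDeriv ℝ (js.length + 1) u y (stdVec ∘ (i :: js).get)) x (stdVec j) :=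
            congrArg (fun f => fderiv ℝ f x (stdVec j)) (funext ih)
        _ = iteratedFDeriv ℝ (js.length + 2) u x (Fin.cons (stdVec j) (stdVec ∘ (i :: js).get)) :=
            (iteratedFDeriv_cons_eq_fderiv hu _ _ x).symm
        _ = iteratedFDeriv ℝ (js.length + 2) u x ((stdVec ∘ (i :: j :: js).get) ∘ Equiv.swap 0 1) := by
            rw [stdVec_comp_get_cons i (j :: js), stdVec_comp_get_cons j js, stdVec_comp_get_cons i js,
              cons_cons_comp_swap]
        _ = iteratedFDeriv ℝ (js.length + 2) u x (stdVec ∘ (i :: j :: js).get) :=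
            Literature.Analysis.Calculus.iteratedFDeriv_comp_perm_of_contDiff hu
              (WithTop.coe_le_coe.2 le_top) x _ _
    · rw [show insertIdx i (j :: js) = i :: j :: js by simp [insertIdx, h]]
      rfl

/-- **Smoothness of the jet coordinates** of a smooth field. -/
private theorem contDiff_jetVal (hu : ContDiff ℝ (⊤ : ℕ∞) u) (v : JVar) :
    ContDiff ℝ (⊤ : ℕ∞) (fun y => jetVal u y v) := by
  obtain ⟨a, l⟩ := v
  have h1 : ContDiff ℝ (⊤ : ℕ∞) (fun y => iteratedFDeriv ℝ l.length u y (stdVec ∘ l.get)) :=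
    (ContinuousMultilinearMap.apply ℝ (fun _ : Fin l.length => EuclideanSpace ℝ (Fin 3))
      (EuclideanSpace ℝ (Fin 3)) (stdVec ∘ l.get)).contDiff.comp (contDiff_iteratedFDeriv_of_contDiff hu l.length)
  exact (contDiff_piLp 2).1 h1 a

/-- **Directional derivative of a jet coordinate**: `∂_w (D^{|l|}u(·)(e_l)_a)(x) = D^{|l|+1}u(x)(w, e_l)_a`
(chain rule through the evaluation at `e_l` and the coordinate projection `a`). -/
private theorem fderiv_jetVal_apply (hu : ContDiff ℝ (⊤ : ℕ∞) u) (a : Fin 3) (l : List (Fin 3))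
    (x w : EuclideanSpace ℝ (Fin 3)) :
    fderiv ℝ (fun y => jetVal u y (a, l)) x w =
      iteratedFDeriv ℝ (l.length + 1) u x (Fin.cons w (stdVec ∘ l.get)) a := by
  have hd : DifferentiableAt ℝ (iteratedFDeriv ℝ l.length u) x :=
    differentiableAt_iteratedFDeriv_of_contDiff hu _ x
  have hg : HasFDerivAt (fun y => iteratedFDeriv ℝ l.length u y (stdVec ∘ l.get))
      (fderiv ℝ (fun y => iteratedFDeriv ℝ l.length u y (stdVec ∘ l.get)) x) x :=
    (hd.continuousMultilinear_apply_const (stdVec ∘ l.get)).hasFDerivAt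
  have h0 := (PiLp.hasFDerivAt_apply (𝕜 := ℝ) 2 (iteratedFDeriv ℝ l.length u x (stdVec ∘ l.get)) a).comp x hg
  have h : HasFDerivAt (fun y => jetVal u y (a, l))
      ((PiLp.proj 2 (fun _ : Fin 3 => ℝ) a).comp
        (fderiv ℝ (fun y => iteratedFDeriv ℝ l.length u y (stdVec ∘ l.get)) x)) x := h0
  rw [h.fderiv, ContinuousLinearMap.comp_apply, fderiv_continuousMultilinear_apply_const_apply hd,
    iteratedFDeriv_succ_apply_left, Fin.cons_zero, Fin.tail_cons]
  rfl

/-- **`D_i` on a variable**: `∂_i (jetVal u · v)(x) = jetVal u x (v.1, insertIdx i v.2)`. -/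
private theorem fderiv_jetVal_stdVec (hu : ContDiff ℝ (⊤ : ℕ∞) u) (v : JVar) (i : Fin 3)
    (x : EuclideanSpace ℝ (Fin 3)) :
    fderiv ℝ (fun y => jetVal u y v) x (stdVec i) = jetVal u x (v.1, insertIdx i v.2) := by
  obtain ⟨a, l⟩ := v
  rw [fderiv_jetVal_apply hu a l x (stdVec i), jetVal_pair, iteratedFDeriv_insertIdx hu i l x,
    stdVec_comp_get_cons]

/-- **Leibniz rule over a monomial**: the product of jet coordinates over a variable list is smooth along the jets
of a smooth field, and its `e_i`-derivative is the sum of the monomials of `derivVars i`. -/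
private theorem monomial_sound (hu : ContDiff ℝ (⊤ : ℕ∞) u) (m : List JVar) :
    ContDiff ℝ (⊤ : ℕ∞) (fun y => (m.map (jetVal u y)).prod) ∧
      ∀ (i : Fin 3) (x : EuclideanSpace ℝ (Fin 3)),
        fderiv ℝ (fun y => (m.map (jetVal u y)).prod) x (stdVec i) =
          ((JPoly.derivVars i m).map fun l => (l.map (jetVal u x)).prod).sum := by
  induction m with
  | nil =>
    refine ⟨by simpa using contDiff_const, fun i x => ?_⟩
    simp [JPoly.derivVars]
  | cons v vs ih =>
    have hv : ContDiff ℝ (⊤ : ℕ∞) (fun y => jetVal u y v) := contDiff_jetVal hu v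
    have hprod : ContDiff ℝ (⊤ : ℕ∞) (fun y => jetVal u y v * (vs.map (jetVal u y)).prod) := hv.mul ih.1
    refine ⟨by simpa using hprod, fun i x => ?_⟩
    have hdv : DifferentiableAt ℝ (fun y => jetVal u y v) x := (hv.differentiable (by simp)).differentiableAt
    have hdvs : DifferentiableAt ℝ (fun y => (vs.map (jetVal u y)).prod) x :=
      (ih.1.differentiable (by simp)).differentiableAt
    simp only [List.map_cons, List.prod_cons]
    rw [fderiv_fun_mul hdv hdvs, add_apply, smul_apply, smul_apply, ih.2 i x, fderiv_jetVal_stdVec hu v i x]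
    simp only [JPoly.derivVars, List.map_cons, List.sum_cons, List.map_map, Function.comp_def, List.prod_cons,
      List.sum_map_mul_left, smul_eq_mul]
    ring

/-- Unfolding of `evalA` on a cons: the head term, then the tail. -/
private theorem evalA_cons_apply (t : ℝ × List JVar) (p : JPoly ℝ) (ζ : JVar → ℝ) :
    JPoly.evalA (t :: p) ζ = t.1 * (t.2.map ζ).prod + JPoly.evalA p ζ := by
  simp [JPoly.evalA]

/-- Unfolding of `evalA (D i ·)` on a cons: the derivative of the head monomial, then the derivative of the tail. -/
private theorem evalA_D_cons (i : Fin 3) (t : ℝ × List JVar) (p : JPoly ℝ) (ζ : JVar → ℝ) :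
    JPoly.evalA (JPoly.D i (t :: p)) ζ =
      t.1 * ((JPoly.derivVars i t.2).map fun l => (l.map ζ).prod).sum + JPoly.evalA (JPoly.D i p) ζ := by
  simp [JPoly.evalA, JPoly.D, List.flatMap_cons, List.sum_map_mul_left, Function.comp_def]

/-- **The total derivative is sound** (stub `D_sound` of crux `OddMorawetzLocal`).  For a smooth field
`u : ℝ³ → ℝ³` and a real jet polynomial `p`, the function `x ↦ p(jetVal u x)` is smooth, and its partial derivative
`∂_i` is the value along the jets of `u` of the list-level total derivative `JPoly.D i p`:
`∂_i (p ∘ jetVal u)(x) = (D i p)(jetVal u x)` (chain rule through the jet coordinates, Leibniz over monomials,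
symmetry of mixed partials for the sorted insertion of the new index). -/
theorem D_sound (u : EuclideanSpace ℝ (Fin 3) → EuclideanSpace ℝ (Fin 3)) (hu : ContDiff ℝ (⊤ : ℕ∞) u)
    (p : JPoly ℝ) :
    ContDiff ℝ (⊤ : ℕ∞) (fun y => JPoly.evalA p (jetVal u y)) ∧
      ∀ (i : Fin 3) (x : EuclideanSpace ℝ (Fin 3)),
        fderiv ℝ (fun y => JPoly.evalA p (jetVal u y)) x (stdVec i) = JPoly.evalA (JPoly.D i p) (jetVal u x) := by
  induction p with
  | nil =>
    refine ⟨by simpa [JPoly.evalA] using contDiff_const, fun i x => ?_⟩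
    simp [JPoly.evalA, JPoly.D]
  | cons t p ih =>
    have ht := monomial_sound hu t.2
    have hsum : ContDiff ℝ (⊤ : ℕ∞)
        (fun y => t.1 * (t.2.map (jetVal u y)).prod + JPoly.evalA p (jetVal u y)) :=
      (contDiff_const.mul ht.1).add ih.1
    simp only [evalA_cons_apply]
    refine ⟨hsum, fun i x => ?_⟩
    have hd1 : DifferentiableAt ℝ (fun y => t.1 * (t.2.map (jetVal u y)).prod) x :=
      ((contDiff_const.mul ht.1).differentiable (by simp)).differentiableAt
    have hd2 : DifferentiableAt ℝ (fun y => JPoly.evalA p (jetVal u y)) x :=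
      (ih.1.differentiable (by simp)).differentiableAt
    have hd3 : DifferentiableAt ℝ (fun y => (t.2.map (jetVal u y)).prod) x :=
      (ht.1.differentiable (by simp)).differentiableAt
    rw [fderiv_fun_add hd1 hd2, add_apply, fderiv_const_mul hd3, smul_apply, ht.2 i x, ih.2 i x, evalA_D_cons,
      smul_eq_mul]

end Summit.NavierStokesRegularity.NavierStokesRegularity.Theorems.OddMorawetz

end
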